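import Summits.BirchSwinnertonDyer.Rank1Residual.X5.TwoAdicTargetsSplitGS
import HarnessLib

/-!
# Class O1 (X5, `p = 2`, non-CM): the EISENSTEIN direction of the main conjecture at a MULTIPLICATIVE
# `2`, typed INTEGRALLY in the Néron normalisation (both signs), with its proved consequence — the
# LOWER half `MissingLowerBoundAt W 2` on «non-CM, analytic rank `0`, multiplicative at `2`»

HONEST FRAMING (cell `bsd-2adic`, run/shared/lean/pub/bsd-2adic/, FULL-BSD rank ≤ 1 programme
tranche 1b, D-0036; seat `bsd-2adic-mult-3`, D-0074 (A) row «find: 19923 `MultLowerHalfAtTwo`»):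
research routes; no claim beyond the stated classes; nothing here is booked; no mark of RESIDUAL-MAP
§I moves. ONE typed target (`@[conjecture] def`, Summits-side, nothing asserted) + bookkeeping
theorems PROVED; 0 named facts. BSD is NOT proved by any of this.

WHY THIS FILE EXISTS (statement-level finding, 2026-08-26). The route item
stmt-BirchSwinnertonDyer-19923 `MultLowerHalfAtTwo` (route `ByReductionTypeAtTwo`, layer-2 child of
`MultiplicativeRankZeroAtTwo`) is `∀ non-CM W, r_an = 0 → Mult W 2 → Typed.MissingLowerBoundAt W 2`,
i.e. `ord₂ #Ш_an ≤ ord₂ #Ш` — the Eisenstein / Skinner–Urban direction `L₂ ∣ char_Λ X` of the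
cyclotomic main conjecture at a MULTIPLICATIVE `2`. The cell had typed that direction only `⊗ℚ`
(`O1.MultLowerDivisibilityAtTwoRat`, `X5/TwoAdicTargetsMultConverse.lean`: `L ∣ 2ⁿ·f_X` — valuation
blind, it feeds the rank-`0` `2`-CONVERSE and nothing else), and EVERY multiplicative-at-`2` END door
(`X5/TwoAdicTargets{MultEndAlpha,SplitEndAlpha,MultKatoRat,SplitGS,MultAuto,SplitAuto,MultPub}.lean`,
bridge `Theorems.multiplicativeRankZeroAtTwo_of_muRoad`) carries the raw binder
`hlow : MissingLowerBoundAt W 2`. The good-ordinary twin exists (`O1.MainConjectureEisensteinDivisibilityAtTwo`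
+ `missingLowerBoundAt_two_of_eisenstein`, `X5/TwoAdicTargetsEisenstein.lean`); this file is the
multiplicative twin, so that 19923 reduces to ONE ∀-closed typed research object
(`Theorems/ByReductionTypeAtTwoMultLowerHalfInputs.lean`, `multLowerHalfAtTwo_of_multEisenstein`).

* **`O1.MultEisensteinDivisibilityAtTwo W` (`@[conjecture]`, T-mult-4-int)** — for the cyclotomic
  `ℤ₂`-extension (`κ` cyclotomic, `γ` a topological generator matching the cyclotomic variable), IF
  `E` (globally minimal `W`) is multiplicative at `2`: for every newform `f` of `W` (any level), every
  rational `ϖ` with `ϖ · Ω_E = Ω⁺_f` (Néron normalisation, as in `MazurMainConjecture W 2` and the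
  ordinary twin), every dual datum `D` of `Sel_{2^∞}(E/ℚ_∞)` and every generator `f_X` of `char_Λ X`:
  (non-split, `a₂ = −1`) for every `L` with `IsMultPAdicLFunctionOf f 2 (-1) L`,
  `ι f_X = ι h · (ϖ · L)` for some `h ∈ Λ` ("`ϖ·L₂ ∣ char X`"); (split, `a₂ = 1`) for every `L` with
  `IsSplitMultPAdicLFunctionOf f 2 L`, `ι(T · f_X) = ι h · (ϖ · L)` ("`ϖ·L₂ ∣ T · char X`": the
  trivial zero of `L₂` charged to the factor `T`, the classical `X` having `f_X(0) ≠ 0` in rank `0`,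
  Greenberg LNM 1716 pp. 112–113). With Kato's direction (K11a / K11b-Rat made integral by `μ = 0`,
  `X5/TwoAdicTargets{Mult,Split}EndAlpha.lean`) it is the cyclotomic main conjecture at a
  multiplicative `2`. NOT IN PRINT at `p = 2` in any case: Skinner, Pacific J. Math. 283 (2016)
  Thm. A/B (`p ≥ 3`, (irr), (ram)); Skinner–Urban 2014 Thm. 3.6.4 (`p ∤ N`, `p` odd); every later
  Eisenstein-congruence main conjecture keeps `p` odd. OPEN; a TARGET; nothing asserted.
* **`lowerBound_two_nonsplit_of_eisensteinDivisibility` (PROVED)** — the LOWER twin of G11a-mult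
  (`chainUpperAtTwoNonsplit_of_divisibilityRat`, `X5/TwoAdicTargetsMultEnd.lean`): non-split `2`,
  `L(E,1) ≠ 0`, GZK, Greenberg's non-split display at `2` (`hEC`, A235 read at `2`), `X` torsion, a
  non-zero rational `ϖ′` with `ord₂ ϖ ≤ ord₂ ϖ′ + k` and an Eisenstein datum
  `ι f_X = ι h · (ϖ′ · L)` ⇒ `∃ q, #Ш_an = q ∧ ord₂ q ≤ ord₂ #Ш + k`: `f_X(0)·#E(ℚ)(2)² = u·2^{ord₂∏c+1}·#Sel`
  and `ι f_X(0) = h(0)·ϖ′·2·[0]⁺_f` give `ord₂ h(0) + ord₂ ϖ′ + ord₂ [0]⁺_f + 2 ord₂ #E(ℚ)_tors =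
  ord₂ ∏c + ord₂ #Ш` with `ord₂ h(0) ≥ 0` (the two factors `2` cancel).
* **`kappaOne_ge_of_greenbergStevens` (PROVED)** — the REVERSE `κ₁`-inequality
  `ord₂ [0]⁺_f + (ord₂ 𝓛₂(E) − 2) ≤ ord₂ c₁` at a split `2` from the Greenberg–Stevens formula
  `greenberg_stevens W 2` (which gives EQUALITY; the forward inequality is
  `kappaOne_of_greenbergStevens`, `X5/TwoAdicTargetsSplitGS.lean`) — the input of the split lower
  chain of part 2.
* Part 2 (`X5/TwoAdicTargetsMultEisensteinLower.lean`): the split lower chain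
  `lowerBound_two_split_of_eisensteinDivisibility` and the per-curve consumers
  `missingLowerBoundAt_two_{nonsplit,split}_of_multEisenstein`, `missingLowerBoundAt_two_of_multEisenstein`
  (the SHARP lower half on «analytic rank `0`, multiplicative at `2`» from the typed target, PRINT
  {A235/A236 at `2`, modularity, GZK}, `X` torsion and, at a split `2`, `greenberg_stevens W 2`).
* **`multEisenstein_nonsplit_of_charIdeal_eq`, `multEisenstein_split_of_charIdeal_eq` (PROVED)** —
  the main conjecture at a non-split / split `2`-adic datum (`char X = (g)`, `ι g = ϖ′·L`, resp.
  `ι(T·g) = ϖ′·L` — the conclusions of `mainConjectureAtTwo{Nonsplit,Split}_of_divisibilityRat_of_le`)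
  gives the Eisenstein datum for every generator (a second generator is `u·g`, `u ∈ Λˣ`).

What this is NOT: not a proof of 19923 (the target is OPEN and not in print at `2`); not a class-level
discharge (per class the lower half stays a `2^∞`-descent certificate or the `λ`/`μ`-pinch of
`X5/TwoAdicTargetsMultPinch.lean` / `Theorems/ByReductionTypeAtTwoLambdaConstPinch.lean`); not a
statement about the `⊗ℚ` target T-mult-4 (which it refines: `n = max(0, −ord₂ ϖ)`), nor about rank `1`.

References: [Skinner2016PacificMC] Thm. A/B (§1; p ≥ 3; shape only); [SkinnerUrban2014] Conj. 3.6.8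
(p. 45), Thm. 3.6.4 (p. 43; p odd, p ∤ N); [GreenbergLNM1716] §4 pp. 112–113 (analogues of Thm. 4.1 at a
multiplicative prime: `l_v = 2` non-split, `l_v = log_p q/(2p·ord_p q)` split);
[MazurTateTeitelbaum1986Invent] §I.10, §I.14 (`L(0) = (1 − α⁻¹)[0]⁺`), §II.1; [GreenbergStevens1993]
Thm. of the Introduction (p ≥ 5; shape); [Miller2011LMS] Def. 1.1.
-/

set_option autoImplicit false

noncomputable section

open scoped Classical MatrixGroups ModularForm

open CongruenceSubgroup WeierstrassCurve Literature.NumberTheory.EllipticCurves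
  Literature.NumberTheory.EllipticCurves.ModularForms
  Literature.NumberTheory.EllipticCurves.Greenberg1999
  Literature.NumberTheory.EllipticCurves.Wuthrich2014
  Literature.NumberTheory.EllipticCurves.Rank1Residual
  Literature.NumberTheory.EllipticCurves.Rank1Residual.Typed

namespace Summit.BirchSwinnertonDyer.Rank1Residual.X5.O1

variable (W : WeierstrassCurve ℚ) [W.IsElliptic] [W.IsGloballyMinimal]

/-! ## §1 T-mult-4-int: the Eisenstein direction at a multiplicative `2`, Néron normalisation (TYPED) -/

/-- **T-mult-4-int — the EISENSTEIN (Skinner–Urban-side) direction of the cyclotomic main conjecture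
AT a MULTIPLICATIVE `2`, integrally, Néron normalisation, both signs.** For `E/ℚ` (globally minimal
`W`) with `2 ‖ N` (guard `Mult W 2`), the cyclotomic `ℤ₂`-extension `κ` with topological generator `γ`
matching the cyclotomic variable, a newform `f` of `W` (any level), a rational `ϖ` with
`ϖ · Ω_E = Ω⁺_f`, a dual datum `D` of `Sel_{2^∞}(E/ℚ_∞)` and a generator `f_X` of `char_Λ X`:
(i) NON-split (`a₂ = −1`): for every `L` with `IsMultPAdicLFunctionOf f 2 (-1) L` there is `h ∈ Λ`
with `ι f_X = ι h · (ϖ · L)` — `ϖ·L₂(f, −1) ∣ char_Λ X` in `Λ = ℤ₂⟦T⟧` (`ι : Λ ↪ ℚ₂⟦T⟧`);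
(ii) SPLIT (`a₂ = 1`): for every `L` with `IsSplitMultPAdicLFunctionOf f 2 L` there is `h ∈ Λ` with
`ι(T · f_X) = ι h · (ϖ · L)` — `ϖ·L₂(f, 1) ∣ T · char_Λ X`, the trivial zero of `L₂` matched by the
factor `T` (Greenberg, LNM 1716 pp. 112–113: the classical `X` has `f_X(0) ≠ 0` in rank `0` at a split
`p`). This is the inclusion `Ch_{ℚ_∞}(f) ⊆ (𝓛_f)` that Skinner–Urban obtain at ODD `p ∤ N` from the
Eisenstein ideal of `U(2,2)` (Thm. 3.6.4, p. 43) and Skinner 2016 at odd `p ‖ N` (Thm. A/B: `p ≥ 3`,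
`E[p]` irreducible, (ram)); the multiplicative twin of `MainConjectureEisensteinDivisibilityAtTwo`
(good ordinary `2`) and the integral refinement of T-mult-4 `MultLowerDivisibilityAtTwoRat`. On a
rank-`0` curve it is the half that bounds `#Ш[2^∞]` from BELOW (`missingLowerBoundAt_two_of_multEisenstein`).
NOTHING in print or announced at `p = 2`. OPEN; a TARGET; nothing asserted.
[cite: Skinner2016PacificMC, Thm. A and Thm. B (§1; p ≥ 3, (irr), (ram); shape only, nothing asserted)]
[cite: SkinnerUrban2014, Thm. 3.6.4 and its proof (p. 43) and Conj. 3.6.8 (p. 45) (p odd, p ∤ N; shape only)]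
[cite: GreenbergLNM1716, §4 pp. 112–113] [cite: MazurTateTeitelbaum1986Invent, §I.10, §I.14] -/
@[conjecture] def MultEisensteinDivisibilityAtTwo : Prop :=
  ∀ (κ : ZpExtension ℚ 2) (γ : Field.absoluteGaloisGroup ℚ), κ.IsCyclotomic →
    κ.IsTopGenerator γ → IsCyclotomicVariable 2 γ → Mult W 2 →
    ∀ ⦃N : ℕ⦄ [NeZero N] (f : CuspForm (Gamma0 N) 2), IsNewformOf W f →
    ∀ (ϖ : ℚ), (ϖ : ℝ) * W.realPeriodRat = plusPeriod f →
    ∀ (D : W.SelmerDualData κ γ) (fE : IwasawaAlgebra 2), D.charIdeal = Ideal.span {fE} →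
      (¬ W.HasSplitMultiplicativeReductionAtPrime 2 →
        ∀ L : PowerSeries ℚ_[2], IsMultPAdicLFunctionOf f 2 (-1) L →
          ∃ h : IwasawaAlgebra 2, iwasawaToPowerSeries 2 fE =
            iwasawaToPowerSeries 2 h * (PowerSeries.C (ϖ : ℚ_[2]) * L)) ∧
      (W.HasSplitMultiplicativeReductionAtPrime 2 →
        ∀ L : PowerSeries ℚ_[2], IsSplitMultPAdicLFunctionOf f 2 L →
          ∃ h : IwasawaAlgebra 2, iwasawaToPowerSeries 2 (PowerSeries.X * fE) =
            iwasawaToPowerSeries 2 h * (PowerSeries.C (ϖ : ℚ_[2]) * L))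

omit [W.IsElliptic] [W.IsGloballyMinimal] in
/-- Off the multiplicative locus the target holds VACUOUSLY (its guard `Mult W 2`). [folklore] -/
theorem multEisensteinDivisibilityAtTwo_of_not_mult (h : ¬ Mult W 2) :
    MultEisensteinDivisibilityAtTwo W :=
  fun _ _ _ _ _ hm => absurd hm h

/-! ## §2 The main conjecture at a `2`-adic datum gives the Eisenstein datum (bookkeeping) -/

omit [W.IsElliptic] [W.IsGloballyMinimal] in
/-- **MC ⇒ Eisenstein datum, non-split shape.** If `char_Λ X = (g)` with `ι g = ϖ′ · L` (the
conclusion of `mainConjectureAtTwoNonsplit_of_divisibilityRat_of_le`), then every generator `f_X` of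
`char_Λ X` is `u · g` for a unit `u` (`Λ` a domain), so `ι f_X = ι u · (ϖ′ · L)`. Bookkeeping.
[cite: SkinnerUrban2014, Conj. 3.6.8 (p. 45) (shape)] -/
theorem multEisenstein_nonsplit_of_charIdeal_eq {κ : ZpExtension ℚ 2}
    {γ : Field.absoluteGaloisGroup ℚ} (D : W.SelmerDualData κ γ) {ϖ' : ℚ} {L : PowerSeries ℚ_[2]}
    (hmc : ∃ g : IwasawaAlgebra 2, D.charIdeal = Ideal.span {g} ∧
      iwasawaToPowerSeries 2 g = PowerSeries.C (ϖ' : ℚ_[2]) * L)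
    (fE : IwasawaAlgebra 2) (hchar : D.charIdeal = Ideal.span {fE}) :
    ∃ h : IwasawaAlgebra 2, iwasawaToPowerSeries 2 fE =
      iwasawaToPowerSeries 2 h * (PowerSeries.C (ϖ' : ℚ_[2]) * L) := by
  obtain ⟨g, hcharg, hι⟩ := hmc
  have hspan : Ideal.span ({fE} : Set (IwasawaAlgebra 2)) = Ideal.span {g} := by
    rw [← hchar, hcharg]
  obtain ⟨u, hu⟩ := Ideal.span_singleton_eq_span_singleton.mp hspan.symm
  refine ⟨(u : IwasawaAlgebra 2), ?_⟩
  rw [← hu, map_mul, hι, mul_comm]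

omit [W.IsElliptic] [W.IsGloballyMinimal] in
/-- **MC ⇒ Eisenstein datum, split shape.** If `char_Λ X = (g)` with `ι(T · g) = ϖ′ · L` (the conclusion
of `mainConjectureAtTwoSplit_of_divisibilityRat_of_le`), then for every generator `f_X = u · g`:
`ι(T · f_X) = ι u · (ϖ′ · L)`. Bookkeeping. [cite: SkinnerUrban2014, Conj. 3.6.8 (p. 45) (shape)] -/
theorem multEisenstein_split_of_charIdeal_eq {κ : ZpExtension ℚ 2}
    {γ : Field.absoluteGaloisGroup ℚ} (D : W.SelmerDualData κ γ) {ϖ' : ℚ} {L : PowerSeries ℚ_[2]}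
    (hmc : ∃ g : IwasawaAlgebra 2, D.charIdeal = Ideal.span {g} ∧
      iwasawaToPowerSeries 2 (PowerSeries.X * g) = PowerSeries.C (ϖ' : ℚ_[2]) * L)
    (fE : IwasawaAlgebra 2) (hchar : D.charIdeal = Ideal.span {fE}) :
    ∃ h : IwasawaAlgebra 2, iwasawaToPowerSeries 2 (PowerSeries.X * fE) =
      iwasawaToPowerSeries 2 h * (PowerSeries.C (ϖ' : ℚ_[2]) * L) := by
  obtain ⟨g, hcharg, hι⟩ := hmc
  have hspan : Ideal.span ({fE} : Set (IwasawaAlgebra 2)) = Ideal.span {g} := by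
    rw [← hchar, hcharg]
  obtain ⟨u, hu⟩ := Ideal.span_singleton_eq_span_singleton.mp hspan.symm
  refine ⟨(u : IwasawaAlgebra 2), ?_⟩
  rw [← hu, ← hι, map_mul, map_mul, map_mul]
  ring

/-! ## §3 The LOWER twin of G11a-mult: an Eisenstein datum at a non-split `2` bounds `#Ш_an` by `#Ш` -/

/-- **Lower chain at a NON-SPLIT multiplicative `2` (PROVED).** Let `W` be globally minimal, non-split
multiplicative at `2` (`hmult`, `hns`), `L(E,1) ≠ 0` (`hL`); GZK (`hGZK`: `E(ℚ)` and `Ш` finite,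
`#Ш_an = t · #E(ℚ)² / ∏c_ℓ` with `t = L(E,1)/Ω_E`); Greenberg's non-split display AT `2` (`hEC`, A235,
`δ = 0`). Fix a cyclotomic datum, a newform `f` of `E`, a `2`-adic `L`-function `L` of `f` with
`α = −1` (`L(0) = 2·[0]⁺_f`), a dual datum `D` with `X` torsion (`hX`), the period ratio `ϖ`
(`ϖ · Ω_E = Ω⁺_f`), a non-zero rational `ϖ′` with `ord₂ ϖ ≤ ord₂ ϖ′ + k`, and an EISENSTEIN datum: every
generator `f_X` of `char_Λ X` satisfies `ι f_X = ι h · (ϖ′ · L)` for some `h ∈ Λ`. Then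
`∃ q, #Ш_an = q ∧ ord₂ q ≤ ord₂ #Ш + k`. Proof: `f_X(0)·#E(ℚ)(2)² = u·2^{ord₂ ∏c + 1}·#Sel` (A235 at `2`),
`ι f_X(0) = h(0)·ϖ′·2·[0]⁺_f`, the two factors `2` cancel, `#Sel = #Ш(2)`, so
`ord₂ h(0) + ord₂ ϖ′ + ord₂ [0]⁺_f + 2 ord₂ #E(ℚ)_tors = ord₂ ∏c + ord₂ #Ш` with `ord₂ h(0) ≥ 0`, and
`ord₂ #Ш_an = ord₂ ϖ + ord₂ [0]⁺_f + 2 ord₂ #E(ℚ)_tors − ord₂ ∏c`.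
[cite: GreenbergLNM1716, §4 pp. 112–113 (analogue of Thm. 4.1, l_v = 2)]
[cite: MazurTateTeitelbaum1986Invent, §I.10 and §I.14 (L(0) = (1 − α⁻¹)[0]⁺, α = −1)]
[cite: Miller2011LMS, Def. 1.1 and §1] -/
theorem lowerBound_two_nonsplit_of_eisensteinDivisibility
    (hEC : TwoAdicEulerCharRankZeroNonsplitMult W 0)
    (hGZK : rank_eq_analyticRank_of_analyticRank_le_one)
    (hmult : Mult W 2) (hns : ¬ W.HasSplitMultiplicativeReductionAtPrime 2)
    (hL : W.entireLFunction 1 ≠ 0)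
    {κ : ZpExtension ℚ 2} {γ : Field.absoluteGaloisGroup ℚ} {N : ℕ} [NeZero N]
    {f : CuspForm (Gamma0 N) 2} (hκ : κ.IsCyclotomic) (hγ : κ.IsTopGenerator γ)
    (hγ' : IsCyclotomicVariable 2 γ) (hf : IsNewformOf W f) {L : PowerSeries ℚ_[2]}
    (hLf : IsMultPAdicLFunctionOf f 2 (-1) L) (D : W.SelmerDualData κ γ) (hX : D.IsTorsion) (ϖ : ℚ)
    (hϖ : (ϖ : ℝ) * W.realPeriodRat = plusPeriod f) {ϖ' : ℚ} (hϖ'0 : ϖ' ≠ 0) (k : ℕ)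
    (hk : padicValRat 2 ϖ ≤ padicValRat 2 ϖ' + k)
    (hdiv : ∀ fE : IwasawaAlgebra 2, D.charIdeal = Ideal.span {fE} →
      ∃ h : IwasawaAlgebra 2, iwasawaToPowerSeries 2 fE =
        iwasawaToPowerSeries 2 h * (PowerSeries.C (ϖ' : ℚ_[2]) * L)) :
    ∃ q : ℚ, shaAn W = (q : ℂ) ∧ padicValRat 2 q ≤ (padicValNat 2 W.shaOrder : ℤ) + k := by
  -- Step 0: `t = ϖ · s = L(E,1)/Ω_E`, `s = [0]⁺_f ≠ 0`
  have hΩpos : 0 < W.realPeriodRat := W.realPeriodRat_pos_holds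
  have hϖ0 : ϖ ≠ 0 := by
    rintro rfl
    have hper : 0 < plusPeriod f := IsNewform0.plusPeriod_pos_holds hf.1 hf.coeffField_eq_bot
    rw [← hϖ, Rat.cast_zero, zero_mul] at hper
    exact lt_irrefl _ hper
  set s : ℚ := ratPlusSymbol f 0 with hs_def
  set t : ℚ := ϖ * s with ht_def
  have hLval : W.entireLFunction 1 = (((s : ℝ) * plusPeriod f : ℝ) : ℂ) := hf.entireLFunction_one_eq
  have hq : W.entireLFunction 1 / (W.realPeriodRat : ℂ) = ((t : ℚ) : ℂ) := by
    rw [hLval, ← hϖ, div_eq_iff (Complex.ofReal_ne_zero.mpr hΩpos.ne'), ht_def]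
    push_cast
    ring
  have hs0 : s ≠ 0 := by
    intro h0
    apply hL
    rw [hLval, h0]
    simp
  have hvt : padicValRat 2 t = padicValRat 2 ϖ + padicValRat 2 s := by
    rw [ht_def, padicValRat.mul hϖ0 hs0]
  -- Step 1: finiteness from GZK (rank 0): `E(ℚ)`, `Ш`, `Sel_{2^∞}(E/ℚ)` finite
  obtain ⟨-, hE, hfin, hshaAn⟩ := shaAn_eq_of_L_one_div_eq hGZK W hL hq
  haveI := hE
  haveI : Finite W.sha := hfin
  have hShapfin : Finite (AddCommGroup.primaryComponent W.sha 2) :=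
    Finite.of_injective _ Subtype.val_injective
  have hSelfin : Finite (W.selmerGroupPInfty 2) :=
    (W.finite_selmerGroupPInfty_iff 2).mpr ⟨hE, hShapfin⟩
  haveI := hSelfin
  haveI : Module.Finite (IwasawaAlgebra 2) D.X := D.module_finite_holds hγ
  -- Step 2: a generator `fE` of `char X` and the Eisenstein cofactor `h`
  haveI : (Module.charIdeal (IwasawaAlgebra 2) D.X).IsPrincipal := charIdeal_isPrincipal_holds 2 D.X
  obtain ⟨fE, hchar⟩ := Submodule.IsPrincipal.principal (Module.charIdeal (IwasawaAlgebra 2) D.X)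
  have hchar' : D.charIdeal = Ideal.span {fE} := hchar
  obtain ⟨h, hιfE⟩ := hdiv fE hchar'
  -- Step 3 (interpolation at a non-split multiplicative prime): `ι fE (0) = h(0) · ϖ′ · 2 · s`
  set h0 : ℚ_[2] := ((PowerSeries.constantCoeff h : ℤ_[2]) : ℚ_[2]) with hh0
  have hfE0Q : ((PowerSeries.constantCoeff fE : ℤ_[2]) : ℚ_[2]) =
      h0 * ((ϖ' : ℚ_[2]) * (2 * (s : ℚ_[2]))) := by
    rw [← constantCoeff_iwasawaToPowerSeries 2 fE, hιfE, map_mul, map_mul,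
      PowerSeries.constantCoeff_C, hLf.constantCoeff_of_neg_one, hh0,
      constantCoeff_iwasawaToPowerSeries 2 h]
  have hsQ0 : (s : ℚ_[2]) ≠ 0 := by exact_mod_cast hs0
  have hϖ'Q0 : (ϖ' : ℚ_[2]) ≠ 0 := by exact_mod_cast hϖ'0
  have h20 : (2 : ℚ_[2]) ≠ 0 := two_ne_zero
  -- Step 4 (Greenberg's analogue of Thm. 4.1 at the non-split `2`, hypothesis `hEC`, slot `δ = 0`)
  obtain ⟨u₁, hu₁⟩ := hEC hmult hns κ γ hκ hγ hγ' D hX fE hchar' hSelfin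
  rw [add_zero, zpow_natCast] at hu₁
  -- Step 5 (the remaining bridges)
  haveI : NeZero (2 : ℕ) := ⟨two_ne_zero⟩
  obtain ⟨u₄, hu₄⟩ := exists_unit_torsionOrder_eq W 2
  obtain ⟨u₅, hu₅⟩ := exists_unit_natCard_eq_mul_card_primaryComponent W.sha 2
  have hSel : Nat.card (W.selmerGroupPInfty 2) = Nat.card (AddCommGroup.primaryComponent W.sha 2) :=
    W.natCard_selmerGroupPInfty_eq_natCard_primaryComponent_sha 2
  set v := padicValNat 2 W.tamagawaProduct with hv
  set Tp : ℚ_[2] := (Nat.card (AddCommGroup.primaryComponent W.toAffine.Point 2) : ℚ_[2]) with hTp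
  set Shp : ℚ_[2] := (Nat.card (AddCommGroup.primaryComponent W.sha 2) : ℚ_[2]) with hShp
  have hu₄' : (W.torsionOrder : ℚ_[2]) = ((u₄ : ℤ_[2]) : ℚ_[2]) * Tp := by
    rw [hu₄, hTp]
    congr 1
    exact_mod_cast natCard_primaryComponent_point_congr W 2 _ _
  have hSha : (W.shaOrder : ℚ_[2]) = ((u₅ : ℤ_[2]) : ℚ_[2]) * Shp := by
    rw [WeierstrassCurve.shaOrder, hShp]
    exact hu₅
  have hSel' : (Nat.card (W.selmerGroupPInfty 2) : ℚ_[2]) = Shp := by rw [hShp, hSel]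
  have hTp0 : Tp ≠ 0 := by rw [hTp]; exact_mod_cast Nat.card_pos.ne'
  have hShp0 : Shp ≠ 0 := by rw [hShp]; exact_mod_cast Nat.card_pos.ne'
  -- `fE(0) ≠ 0` (the right-hand side of the display is non-zero), hence `h(0) ≠ 0`
  have hfE00 : ((PowerSeries.constantCoeff fE : ℤ_[2]) : ℚ_[2]) ≠ 0 := by
    intro h0'
    have := hu₁
    rw [h0', zero_mul, hSel'] at this
    exact (mul_ne_zero (mul_ne_zero (coe_units_ne_zero 2 u₁) (pow_ne_zero _ h20)) hShp0) this.symm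
  have hh0ne : h0 ≠ 0 := by
    intro h0'
    apply hfE00
    rw [hfE0Q, h0', zero_mul]
  have hh0val : 0 ≤ h0.valuation := by
    rw [hh0]
    exact PadicInt.valuation_coe_nonneg
  -- Step 6: the identity `h0 · ϖ′ · (2 s) · Tp² = u₁ · 2^(v+1) · Shp` in `ℚ_2`
  have key : h0 * (ϖ' : ℚ_[2]) * (2 * (s : ℚ_[2])) * Tp ^ 2 =
      ((u₁ : ℤ_[2]) : ℚ_[2]) * (2 : ℚ_[2]) ^ (v + 1) * Shp := by
    calc h0 * (ϖ' : ℚ_[2]) * (2 * (s : ℚ_[2])) * Tp ^ 2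
        = ((PowerSeries.constantCoeff fE : ℤ_[2]) : ℚ_[2]) * Tp ^ 2 := by rw [hfE0Q]; ring
      _ = ((u₁ : ℤ_[2]) : ℚ_[2]) * (2 : ℚ_[2]) ^ (v + 1) *
            (Nat.card (W.selmerGroupPInfty 2) : ℚ_[2]) := hu₁
      _ = ((u₁ : ℤ_[2]) : ℚ_[2]) * (2 : ℚ_[2]) ^ (v + 1) * Shp := by rw [hSel']
  -- Step 7: valuations
  have hv2 : (2 : ℚ_[2]).valuation = 1 := by
    have h2 : ((2 : ℕ) : ℚ_[2]).valuation = 1 := Padic.valuation_p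
    rwa [Nat.cast_ofNat] at h2
  have hvalL : (h0 * (ϖ' : ℚ_[2]) * (2 * (s : ℚ_[2])) * Tp ^ 2).valuation =
      h0.valuation + padicValRat 2 ϖ' + (1 + padicValRat 2 s) + 2 * Tp.valuation := by
    rw [Padic.valuation_mul (mul_ne_zero (mul_ne_zero hh0ne hϖ'Q0) (mul_ne_zero h20 hsQ0))
        (pow_ne_zero 2 hTp0),
      Padic.valuation_mul (mul_ne_zero hh0ne hϖ'Q0) (mul_ne_zero h20 hsQ0),
      Padic.valuation_mul hh0ne hϖ'Q0, Padic.valuation_mul h20 hsQ0, Padic.valuation_pow Tp, hv2,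
      Padic.valuation_ratCast, Padic.valuation_ratCast]
    push_cast
    ring
  have hvalR : (((u₁ : ℤ_[2]) : ℚ_[2]) * (2 : ℚ_[2]) ^ (v + 1) * Shp).valuation =
      ((v : ℤ) + 1) + Shp.valuation := by
    rw [Padic.valuation_mul (mul_ne_zero (coe_units_ne_zero 2 u₁) (pow_ne_zero _ h20)) hShp0,
      Padic.valuation_mul (coe_units_ne_zero 2 u₁) (pow_ne_zero _ h20), valuation_coe_units_eq_zero,
      Padic.valuation_pow, hv2]
    push_cast
    ring
  have hval := congrArg Padic.valuation key
  rw [hvalL, hvalR] at hval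
  have hvT : Tp.valuation = (padicValNat 2 W.torsionOrder : ℤ) := by
    have h' := congrArg Padic.valuation hu₄'
    rw [Padic.valuation_natCast, Padic.valuation_mul (coe_units_ne_zero 2 u₄) hTp0,
      valuation_coe_units_eq_zero, zero_add] at h'
    exact h'.symm
  have hvS : Shp.valuation = (padicValNat 2 W.shaOrder : ℤ) := by
    have h' := congrArg Padic.valuation hSha
    rw [Padic.valuation_natCast, Padic.valuation_mul (coe_units_ne_zero 2 u₅) hShp0,
      valuation_coe_units_eq_zero, zero_add] at h'
    exact h'.symm
  rw [hvT, hvS] at hval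
  -- Step 8: Miller's currency `#Ш_an = t · #E(ℚ)² / ∏ c_ℓ`
  have ht0 : t ≠ 0 := mul_ne_zero hϖ0 hs0
  have hcard : (Nat.card W.toAffine.Point : ℚ) ≠ 0 := by
    exact_mod_cast (Nat.card_pos (α := W.toAffine.Point)).ne'
  have htam : (W.tamagawaProduct : ℚ) ≠ 0 := by
    exact_mod_cast (W.tamagawaProduct_pos_holds : 0 < W.tamagawaProduct).ne'
  have hcardT : (Nat.card W.toAffine.Point : ℚ) = (W.torsionOrder : ℚ) := by
    exact_mod_cast (W.torsionOrder_eq_natCard_of_finite).symm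
  refine ⟨t * (Nat.card W.toAffine.Point : ℚ) ^ 2 / (W.tamagawaProduct : ℚ), hshaAn, ?_⟩
  rw [padicValRat.div (mul_ne_zero ht0 (pow_ne_zero 2 hcard)) htam,
    padicValRat.mul ht0 (pow_ne_zero 2 hcard), padicValRat.pow, hcardT]
  simp only [padicValRat.of_nat, Nat.cast_ofNat]
  linarith

/-! ## §4 The reverse `κ₁`-inequality at a split `2` from the Greenberg–Stevens formula -/

omit [W.IsGloballyMinimal] in
/-- **The reverse `κ₁`-inequality from Greenberg–Stevens at `2` (PROVED).** `greenberg_stevens W 2`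
(`c₁ · log₂ γ = 𝓛₂(E) · [0]⁺_f`) gives, for every newform `f` of `W`, every split `2`-adic `L`-function
`L` of `f` and every Tate datum, `ord₂ [0]⁺_f + (ord₂ 𝓛₂(E) − 2) ≤ ord₂ c₁` — the inequality OPPOSITE to
the `κ₁`-certificate `kappaOne_of_greenbergStevens` (both hold: `ord₂ log₂ 5 = 2`, so the formula is an
equality of valuations when `[0]⁺_f ≠ 0`; when `[0]⁺_f = 0` also `c₁ = 0` and both sides read `0 + _`
— we only use it with `L(E,1) ≠ 0`, so we assume `r_an = 0`). [cite: MazurTateTeitelbaum1986Invent, §II.10 (shape)]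
[cite: GreenbergStevens1993, Thm. of the Introduction (p ≥ 5; shape)] -/
theorem kappaOne_ge_of_greenbergStevens (hGS : greenberg_stevens (W := W) (p := 2))
    (hr : W.analyticRank = 0) {N : ℕ} [NeZero N] {f : CuspForm (Gamma0 N) 2}
    (hf : IsNewformOf W f) {L : PowerSeries ℚ_[2]} (hL : IsSplitMultPAdicLFunctionOf f 2 L)
    (Dq : TateParameterData W 2) :
    padicValRat 2 (ratPlusSymbol f 0) + ((LInvariant Dq).valuation - 2) ≤
      (PowerSeries.coeff 1 L).valuation := by
  obtain ⟨-, hGS1⟩ := hGS Dq hf hL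
  have hlog0 := padicLog_cyclotomicGenerator_two_ne_zero
  have hs0 : (ratPlusSymbol f 0 : ℚ_[2]) ≠ 0 := by
    have hL1 : W.entireLFunction 1 ≠ 0 :=
      (W.analyticRank_eq_zero_iff_holds hf.hasEntireLFunction).mp hr
    exact_mod_cast (ratPlusSymbol_zero_ne_zero_iff W hf).mpr hL1
  have hLI0 := lInvariant_two_ne_zero W Dq
  have hc : PowerSeries.coeff 1 L =
      LInvariant Dq * (ratPlusSymbol f 0 : ℚ_[2]) *
        (padicLog 2 ((cyclotomicGenerator 2 : ℕ) : ℚ_[2]))⁻¹ := by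
    rw [← hGS1, mul_inv_cancel_right₀ hlog0]
  refine le_of_eq ?_
  rw [hc, Padic.valuation_mul (mul_ne_zero hLI0 hs0) (inv_ne_zero hlog0),
    Padic.valuation_mul hLI0 hs0, Padic.valuation_inv, Padic.valuation_ratCast,
    valuation_padicLog_cyclotomicGenerator_two]
  ring

omit [W.IsGloballyMinimal] in
/-- The reverse `κ₁`-inequality in binder shape (newform at level `N_E`). [cite: MazurTateTeitelbaum1986Invent, §II.10 (shape)] -/
theorem kappaOne_ge_binder_of_greenbergStevens (hGS : greenberg_stevens (W := W) (p := 2))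
    (hr : W.analyticRank = 0) :
    ∀ [NeZero (W.conductorNorm ℤ)] (f : CuspForm (Gamma0 (W.conductorNorm ℤ)) 2),
      IsNewformOf W f → ∀ L : PowerSeries ℚ_[2], IsSplitMultPAdicLFunctionOf f 2 L →
      ∀ Dq : TateParameterData W 2,
        padicValRat 2 (ratPlusSymbol f 0) + ((LInvariant Dq).valuation - 2) ≤
          (PowerSeries.coeff 1 L).valuation :=
  fun _ hf _ hL Dq => kappaOne_ge_of_greenbergStevens W hGS hr hf hL Dq


end Summit.BirchSwinnertonDyer.Rank1Residual.X5.O1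

end
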